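import Summits.Schanuel.Schanuel.Theorems.ZilberEacRealLineSurfaceZeros
import Summits.Schanuel.Schanuel.Theorems.ZilberEacGraphSurfaceUnbalanced
import HarnessLib

/-!
# Non-split surfaces over a line of REAL IRRATIONAL slope, III: tools for the tilted windows
# (positive Kronecker, persistence with a general parameter, real upper edges, torus zeros)

HONEST FRAMING.  Cell `pub-schanuel` (Zilber's Exponential-Algebraic Closedness, case ladder;
host summit Schanuel), seat 2, gen 18 (HANDOFF O68 (a)).  `unprojectedDense_lineSurface_of_irrational`
(`ZilberEacRealLineSurfaceDensity`) needs a torus zero of the top `x`-row; when the top row is a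
monomial the zeros of `P(z; e^z, e^{az+b})` leave every compact window at a logarithmic rate and one
must TILT the windows: `z = ζ' - λ log(2π|n|) + 2πin` with `λ` read off an edge of the upper convex
hull of the points `(m₁ + a m₂, k)` (`x^k y^m ∈ supp P`).  This file collects the tools:
`exists_nat_urot_near` (Kronecker with POSITIVE multipliers), `exists_zero_near_of_near_paramP`
(persistence of zeros for a family parametrised by a proper metric space),
`exists_upper_edge_real` (an upper supporting line of a finite point set with REAL columns through
two points of different column), `exists_torus_zero_of_ne` (a polynomial in `ℂ[y₀, y₁]` with two
different monomials in its support vanishes somewhere on `(ℂˣ)²`).  NOT Schanuel's conjecture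
(neither used nor implied; EAC ⇏ SC); `EC(3,2)` stays OPEN.
-/

noncomputable section

open Filter Topology Metric Set Complex MvPolynomial
open Literature.NumberTheory.Transcendental Literature.ModelTheory.Zilber
open Literature.ModelTheory.ExponentialFields

set_option linter.dupNamespace false

namespace Summit.Schanuel.Schanuel.Theorems

/-! ## Part A. Kronecker with positive multipliers -/

/-- `urot (x + y) = urot x · urot y`. [folklore] -/
theorem urot_add (x y : ℝ) : urot (x + y) = urot x * urot y := by
  rw [urot, urot, urot, ← Complex.exp_add]; push_cast; ring_nf

/-- `‖urot(-x) - 1‖ = ‖urot x - 1‖`. [folklore] -/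
theorem norm_urot_neg_sub_one (x : ℝ) : ‖urot (-x) - 1‖ = ‖urot x - 1‖ := by
  have h1 : urot (-x) * urot x = 1 := by rw [← urot_add, neg_add_cancel, urot]; simp
  have h2 : urot (-x) - 1 = -(urot (-x)) * (urot x - 1) := by
    rw [neg_mul, mul_sub, h1, mul_one, neg_sub]
  rw [h2, norm_mul, norm_neg, norm_urot, one_mul]

/-- **Kronecker on the circle with POSITIVE multipliers**: for irrational `a`, the rotations
`e^{2πina}`, `n ∈ ℕ`, `n ≥ N`, come within any `ε` of any unimodular `u`. [folklore] -/
theorem exists_nat_urot_near {a : ℝ} (ha : Irrational a) {u : ℂ} (hu : ‖u‖ = 1) {ε : ℝ} (hε : 0 < ε)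
    (N : ℕ) : ∃ n : ℕ, N ≤ n ∧ ‖urot (n * a) - u‖ < ε := by
  obtain ⟨n₁, hn₁, h₁⟩ := exists_urot_near ha hu (half_pos hε) N
  rcases le_or_gt 0 n₁ with hpos | hneg
  · refine ⟨n₁.toNat, ?_, ?_⟩
    · have : (N : ℝ) ≤ n₁ := by rwa [abs_of_nonneg (by exact_mod_cast hpos)] at hn₁
      have h' : (N : ℤ) ≤ n₁ := by exact_mod_cast this
      omega
    · have e : ((n₁.toNat : ℕ) : ℝ) = (n₁ : ℝ) := by exact_mod_cast Int.toNat_of_nonneg hpos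
      rw [e]; linarith [h₁]
  · -- correct the sign with a far rotation close to `1`
    obtain ⟨n₂, hn₂, h₂⟩ := exists_urot_near ha (u := 1) (by simp) (half_pos hε)
      (2 * n₁.natAbs + N + 1)
    have hkey : ∀ v : ℂ, ‖v - 1‖ < ε / 2 → ‖urot (n₁ * a) * v - u‖ < ε := by
      intro v hv
      calc ‖urot (n₁ * a) * v - u‖ = ‖urot (n₁ * a) * (v - 1) + (urot (n₁ * a) - u)‖ := by ring_nf
        _ ≤ ‖urot (n₁ * a) * (v - 1)‖ + ‖urot (n₁ * a) - u‖ := norm_add_le _ _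
        _ < ε / 2 + ε / 2 := by
            rw [norm_mul, norm_urot, one_mul]; exact add_lt_add hv h₁
        _ = ε := by ring
    rcases le_or_gt 0 n₂ with h2pos | h2neg
    · have h3 : ((2 * n₁.natAbs + N + 1 : ℕ) : ℝ) ≤ (n₂ : ℝ) := by
        rwa [abs_of_nonneg (show (0 : ℝ) ≤ n₂ by exact_mod_cast h2pos)] at hn₂
      have h4 : ((2 * n₁.natAbs + N + 1 : ℕ) : ℤ) ≤ n₂ := by
        rw [← Int.cast_natCast] at h3; exact Int.cast_le.1 h3
      have hnn : 0 ≤ n₁ + n₂ := by omega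
      refine ⟨(n₁ + n₂).toNat, by omega, ?_⟩
      have e : (((n₁ + n₂).toNat : ℕ) : ℝ) * a = n₁ * a + n₂ * a := by
        rw [show (((n₁ + n₂).toNat : ℕ) : ℝ) = ((n₁ + n₂ : ℤ) : ℝ) by
          exact_mod_cast Int.toNat_of_nonneg hnn]
        push_cast; ring
      rw [e, urot_add]
      exact hkey _ h₂
    · have h3 : ((2 * n₁.natAbs + N + 1 : ℕ) : ℝ) ≤ ((-n₂ : ℤ) : ℝ) := by
        rw [abs_of_neg (show (n₂ : ℝ) < 0 by exact_mod_cast h2neg)] at hn₂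
        rw [Int.cast_neg]; exact hn₂
      have h4 : ((2 * n₁.natAbs + N + 1 : ℕ) : ℤ) ≤ -n₂ := by
        rw [← Int.cast_natCast] at h3; exact Int.cast_le.1 h3
      have hnn : 0 ≤ n₁ - n₂ := by omega
      refine ⟨(n₁ - n₂).toNat, by omega, ?_⟩
      have e : (((n₁ - n₂).toNat : ℕ) : ℝ) * a = n₁ * a + -(n₂ * a) := by
        rw [show (((n₁ - n₂).toNat : ℕ) : ℝ) = ((n₁ - n₂ : ℤ) : ℝ) by
          exact_mod_cast Int.toNat_of_nonneg hnn]
        push_cast; ring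
      rw [e, urot_add]
      refine hkey _ ?_
      rw [norm_urot_neg_sub_one]; exact h₂

/-! ## Part B. Persistence of zeros with a parameter in a proper metric space -/

/-- **Zero persistence, general parameter** (same proof as `exists_zero_near_of_near_param`).
[folklore] -/
theorem exists_zero_near_of_near_paramP {E : Type*} [MetricSpace E] [ProperSpace E]
    {Φ : E → ℂ → ℂ} (hcont : Continuous fun p : E × ℂ => Φ p.1 p.2)
    (hdiff : ∀ v, Differentiable ℂ (Φ v)) {v₀ : E} {x₀ : ℂ} (hne : ∃ z, Φ v₀ z ≠ 0)
    (hx₀ : Φ v₀ x₀ = 0) {ε : ℝ} (hε : 0 < ε) :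
    ∃ δ > 0, ∀ v, dist v v₀ < δ → ∃ ζ, ‖ζ - x₀‖ < ε ∧ Φ v ζ = 0 := by
  obtain ⟨r, hr0, hrε, m, hm0, hm⟩ := exists_sphere_norm_le (hdiff v₀) hne x₀ hε
  set K : Set (E × ℂ) := closedBall v₀ 1 ×ˢ sphere x₀ r with hK
  have hKc : IsCompact K := (isCompact_closedBall v₀ 1).prod (isCompact_sphere x₀ r)
  obtain ⟨δ₁, hδ₁, h₁⟩ := Metric.uniformContinuousOn_iff.1
    (hKc.uniformContinuousOn_of_continuous hcont.continuousOn) (m / 2) (half_pos hm0)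
  have hc2 : Continuous fun v => Φ v x₀ := hcont.comp (continuous_id.prodMk continuous_const)
  obtain ⟨δ₂, hδ₂, h₂⟩ := Metric.continuousAt_iff.1 hc2.continuousAt (m / 2) (half_pos hm0)
  refine ⟨min (min δ₁ δ₂) 1, by positivity, fun v hv => ?_⟩
  have hv1 : dist v v₀ < δ₁ := hv.trans_le ((min_le_left _ _).trans (min_le_left _ _))
  have hv2 : dist v v₀ < δ₂ := hv.trans_le ((min_le_left _ _).trans (min_le_right _ _))
  have hv3 : dist v v₀ < 1 := hv.trans_le (min_le_right _ _)
  have hsphere : ∀ z ∈ sphere x₀ r, m / 2 ≤ ‖Φ v z‖ := by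
    intro z hz
    have hzv : (v, z) ∈ K := ⟨mem_closedBall.2 hv3.le, hz⟩
    have hzv₀ : (v₀, z) ∈ K := ⟨mem_closedBall_self zero_le_one, hz⟩
    have hd : dist (v, z) (v₀, z) < δ₁ := by
      rw [Prod.dist_eq, dist_self, max_lt_iff]; exact ⟨hv1, hδ₁⟩
    have h3 := h₁ (v, z) hzv (v₀, z) hzv₀ hd
    rw [dist_eq_norm] at h3
    have h4 := norm_sub_norm_le (Φ v₀ z) (Φ v z)
    rw [norm_sub_rev] at h4
    linarith [hm z hz]
  have hcentre : ‖Φ v x₀‖ < m / 2 := by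
    have h3 := h₂ hv2
    rwa [hx₀, dist_zero_right] at h3
  obtain ⟨ζ, hζ, hζ0⟩ := exists_zero_of_norm_lt_of_sphere hr0 (lt_add_one r)
    (hdiff v).differentiableOn hsphere hcentre
  exact ⟨ζ, (by rw [← dist_eq_norm]; exact (mem_ball.1 hζ).trans_le hrε), hζ0⟩

/-! ## Part C. Upper supporting lines with real columns -/

/-- **An upper edge, real columns.**  For a finite set `A` with real column `w` and height `nf`
having two elements of different column, there are `μ, κ` with `nf a + μ·w a ≤ κ` on `A` and
equality at two elements of different column. [folklore] -/
theorem exists_upper_edge_real {α : Type*} (A : Finset α) (w : α → ℝ) (nf : α → ℕ)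
    (h2 : ∃ a ∈ A, ∃ a' ∈ A, w a ≠ w a') :
    ∃ μ κ : ℝ, (∀ a ∈ A, (nf a : ℝ) + μ * w a ≤ κ) ∧
      ∃ a ∈ A, ∃ a' ∈ A, w a ≠ w a' ∧ (nf a : ℝ) + μ * w a = κ ∧ (nf a' : ℝ) + μ * w a' = κ := by
  classical
  obtain ⟨a₁, ha₁, a₁', ha₁', hne⟩ := h2
  obtain ⟨a₀, ha₀, hmax⟩ := A.exists_max_image (fun a => nf a) ⟨a₁, ha₁⟩
  set T := A.filter (fun a => w a ≠ w a₀) with hT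
  have hTne : T.Nonempty := by
    by_cases h : w a₁ = w a₀
    · refine ⟨a₁', Finset.mem_filter.2 ⟨ha₁', ?_⟩⟩
      rw [← h]; exact fun h' => hne h'.symm
    · exact ⟨a₁, Finset.mem_filter.2 ⟨ha₁, h⟩⟩
  obtain ⟨as, hasT, hasmin⟩ := T.exists_min_image
    (fun a => ((nf a₀ : ℝ) - nf a) / |w a - w a₀|) hTne
  have hasA : as ∈ A := (Finset.mem_filter.1 hasT).1
  have hasj : w as ≠ w a₀ := (Finset.mem_filter.1 hasT).2
  have hD : w as - w a₀ ≠ 0 := sub_ne_zero.2 hasj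
  set μ : ℝ := ((nf a₀ : ℝ) - nf as) / (w as - w a₀) with hμ
  refine ⟨μ, (nf a₀ : ℝ) + μ * w a₀, fun a ha => ?_, a₀, ha₀, as, hasA, fun h => hasj h.symm, rfl, ?_⟩
  · have hN : (nf a : ℝ) ≤ nf a₀ := by exact_mod_cast hmax a ha
    by_cases h1 : w a = w a₀
    · rw [h1]; linarith
    · have haT : a ∈ T := Finset.mem_filter.2 ⟨ha, h1⟩
      have hDa : w a - w a₀ ≠ 0 := sub_ne_zero.2 h1
      have hDpos : 0 < |w a - w a₀| := abs_pos.2 hDa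
      have hNs : (nf as : ℝ) ≤ nf a₀ := by exact_mod_cast hmax as hasA
      have hr := hasmin a haT
      have habs : |μ| = ((nf a₀ : ℝ) - nf as) / |w as - w a₀| := by
        rw [hμ, abs_div, abs_of_nonneg (by linarith)]
      have h3 : μ * (w a - w a₀) ≤ (nf a₀ : ℝ) - nf a := by
        calc μ * (w a - w a₀) ≤ |μ * (w a - w a₀)| := le_abs_self _
          _ = ((nf a₀ : ℝ) - nf as) / |w as - w a₀| * |w a - w a₀| := by rw [abs_mul, habs]
          _ ≤ ((nf a₀ : ℝ) - nf a) / |w a - w a₀| * |w a - w a₀| :=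
              mul_le_mul_of_nonneg_right hr hDpos.le
          _ = (nf a₀ : ℝ) - nf a := div_mul_cancel₀ _ hDpos.ne'
      linarith
  · have : μ * (w as - w a₀) = (nf a₀ : ℝ) - nf as := by rw [hμ]; exact div_mul_cancel₀ _ hD
    linarith

/-! ## Part D. A two-monomial polynomial has a torus zero -/

/-- A nonzero polynomial in one variable over `ℂ` (as `MvPolynomial (Fin 1) ℂ`) misses some nonzero
point. [folklore] -/
theorem exists_eval_ne_zero_of_ne_zero_fin1 {A : MvPolynomial (Fin 1) ℂ} (hA : A ≠ 0) :
    ∃ t : ℂ, t ≠ 0 ∧ MvPolynomial.eval (fun _ => t) A ≠ 0 := by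
  by_contra h
  push Not at h
  apply mul_ne_zero hA (MvPolynomial.X_ne_zero (0 : Fin 1))
  refine MvPolynomial.funext fun x => ?_
  rw [map_mul, MvPolynomial.eval_X, map_zero]
  by_cases hx : x 0 = 0
  · rw [hx, mul_zero]
  · have e : x = fun _ => x 0 := by funext i; fin_cases i; rfl
    rw [e, h _ hx, zero_mul]

/-- **A polynomial with two monomials of different `y₀`-degree vanishes somewhere on `(ℂˣ)²`**
(fix a generic `y₁ = t ≠ 0`, then `exists_root_ne_zero_of_coeff_ne_zero` in `y₀`). [folklore] -/
theorem exists_torus_zero_of_ne_zero_deg {R : MvPolynomial (Fin 2) ℂ}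
    (h : ∃ m ∈ R.support, ∃ m' ∈ R.support, m 0 ≠ m' 0) :
    ∃ c : Fin 2 → ℂ, c 0 ≠ 0 ∧ c 1 ≠ 0 ∧ MvPolynomial.eval c R = 0 := by
  classical
  obtain ⟨m, hm, m', hm', hne⟩ := h
  set Q := MvPolynomial.finSuccEquiv ℂ 1 R with hQ
  -- the coefficients in degrees `m 0`, `m' 0` are nonzero polynomials in `y₁`
  have hcoef : ∀ d ∈ R.support, Q.coeff (d 0) ≠ 0 := by
    intro d hd h0
    have h1 := MvPolynomial.finSuccEquiv_coeff_coeff (Finsupp.tail d) R (d 0)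
    rw [← hQ, h0, MvPolynomial.coeff_zero, Finsupp.cons_tail] at h1
    exact (MvPolynomial.mem_support_iff.1 hd) h1.symm
  obtain ⟨t, ht0, ht⟩ := exists_eval_ne_zero_of_ne_zero_fin1
    (mul_ne_zero (hcoef m hm) (hcoef m' hm'))
  rw [map_mul] at ht
  set q : Polynomial ℂ := Q.map (MvPolynomial.eval fun _ : Fin 1 => t) with hq
  have hqm : q.coeff (m 0) ≠ 0 := by rw [hq, Polynomial.coeff_map]; exact left_ne_zero_of_mul ht
  have hqm' : q.coeff (m' 0) ≠ 0 := by rw [hq, Polynomial.coeff_map]; exact right_ne_zero_of_mul ht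
  obtain ⟨s, hs0, hs⟩ : ∃ s : ℂ, s ≠ 0 ∧ q.eval s = 0 := by
    rcases lt_or_gt_of_ne hne with hlt | hgt
    · exact exists_root_ne_zero_of_coeff_ne_zero (m' 0) q (m 0) hlt hqm hqm'
    · exact exists_root_ne_zero_of_coeff_ne_zero (m 0) q (m' 0) hgt hqm' hqm
  refine ⟨Fin.cons s (fun _ => t), by simpa using hs0, by simpa using ht0, ?_⟩
  rw [MvPolynomial.eval_eq_eval_mv_eval', ← hQ, ← hq]
  exact hs

/-- **A polynomial with two different monomials vanishes somewhere on `(ℂˣ)²`** (if all monomials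
share the `y₀`-degree, swap the variables). [folklore] -/
theorem exists_torus_zero_of_ne {R : MvPolynomial (Fin 2) ℂ}
    (h : ∃ m ∈ R.support, ∃ m' ∈ R.support, m ≠ m') :
    ∃ c : Fin 2 → ℂ, c 0 ≠ 0 ∧ c 1 ≠ 0 ∧ MvPolynomial.eval c R = 0 := by
  classical
  obtain ⟨m, hm, m', hm', hne⟩ := h
  by_cases h0 : m 0 ≠ m' 0
  · exact exists_torus_zero_of_ne_zero_deg ⟨m, hm, m', hm', h0⟩
  · push Not at h0
    have h1 : m 1 ≠ m' 1 := by
      intro h1; apply hne; ext i; fin_cases i; exacts [h0, h1]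
    -- swap the variables
    set τ : Fin 2 ≃ Fin 2 := Equiv.swap 0 1 with hτ
    set R' := rename τ R with hR'
    have hsupp : R'.support = Finset.image (Finsupp.mapDomain τ) R.support :=
      support_rename_of_injective τ.injective
    have hmem : ∀ d ∈ R.support, Finsupp.mapDomain τ d ∈ R'.support := fun d hd => by
      rw [hsupp]; exact Finset.mem_image_of_mem _ hd
    have hdeg : ∀ d : Fin 2 →₀ ℕ, (Finsupp.mapDomain τ d) 0 = d 1 := fun d => by
      have e : (0 : Fin 2) = τ 1 := by simp [hτ]
      rw [e, Finsupp.mapDomain_apply τ.injective]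
    obtain ⟨c, hc0, hc1, hc⟩ := exists_torus_zero_of_ne_zero_deg (R := R')
      ⟨_, hmem m hm, _, hmem m' hm', by rwa [hdeg, hdeg]⟩
    refine ⟨c ∘ τ, by simpa [hτ] using hc1, by simpa [hτ] using hc0, ?_⟩
    rw [hR', eval_rename] at hc
    exact hc

end Summit.Schanuel.Schanuel.Theorems
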